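import Literature.Analysis.FluidPDE.HardSphereFlowGroup
import HarnessLib

/-!
# Restarting the collision-by-collision hard-sphere flow: truncated regularity

Fifth layer of the proof of Alexander's theorem on `T^d`
(`Kinetic.HardSphereFlow.nonempty_torus`, reduced in
`Literature.Analysis.FluidPDE.HardSphereFlowConstruction` to five named facts; the deterministic
ones and measurability are discharged in `HardSphereFlowOrbits`, `HardSphereFlowGroup`,
`HardSphereFlowMeasurable`). The two measure-theoretic facts — `torusFlow_ae_good` (Alexander's
theorem: pathological data are null, Gallagher–Saint-Raymond–Texier 2013 Prop. 4.1.1) and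
`torusFlow_measurePreserving` (Liouville) — are proved by iterating a *short-time* analysis over
windows `[mδ, (m+1)δ]` (GST 2013, proof of Prop. 4.1.1: "fix `δ`, … then iterate"). This file
supplies the deterministic glue of that iteration, for an arbitrary geometry:

* **equivariance of the exit time along a free flight**, `τ(S_s z) + s = τ(z)` for
  `0 ≤ s ≤ τ(z)` (`freeExitTime_freeFlight_add`), whence the collision step and the exit
  configuration do not change along a free flight (`collisionStep_freeFlight`);
* frozen dynamics after an infinite free flight and *reachable* states
  (`exists_stateAfter_eq_reachable`), states stay in the domain (`stateAfter_mem_of_mem`);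
* `FwdGoodUpTo G ε T z` — **forward regularity up to time `T`**, the time-`T` truncation of
  `FwdGood` (simple incoming exits at the instants `≤ T`, no grazing touch inside the free
  flights before `T`, some instant beyond `T`), with `FwdGood ↔ ∀ n : ℕ, FwdGoodUpTo n`
  (`fwdGood_iff_forall_fwdGoodUpTo`);
* **restart**: the dynamics restarted at a point `Φ_s z` of the orbit has states
  `z_{k+m}` and instants `t_{k+m} - s` (`stateAfter_fwdFlow_succ`,
  `collisionInstant_fwdFlow_succ_add`), so `Φ_{s+u} z = Φ_u (Φ_s z)` on matching segments
  (`fwdFlow_add_of_segment`), and truncated regularity is additive: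
  `FwdGoodUpTo s z → FwdGoodUpTo u (Φ_s z) → FwdGoodUpTo (s + u) z ∧ Φ_{s+u} z = Φ_u (Φ_s z)`
  (`FwdGoodUpTo.add`) — the semigroup property before knowing that the orbit is globally good
  (CIP 1994 §4.2 p. 65, `T^t T^s = T^{t+s}`).

## Mathlib / Literature reuse

The construction (`freeExitTime`, `collisionStep`, `stateAfter`, `collisionInstant`, `fwdFlow`,
`FwdGood`) is `HardSphereFlowConstruction`'s (the decomposition of the step into free flight and
the resolution `stepMap G (incomingPairs G ε ·)` of the exit configuration is
`HardSphereFlowMeasurable.collisionStep_eq`; it is not needed here); `freeExitTime_le_of_not_mem`,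
`fwdFlow_eq_of_segment`, `ofReal_sub_toReal_lt`, `freeFlight_freeExitTime_mem` are
`HardSphereFlowOrbits`', `stateAfter_one` is `HardSphereFlowGroup`'s.
`ENNReal.tsum_le_of_sum_range_le`, `ENNReal.sum_le_tsum`, `Nat.find` are Mathlib's. Mathlib has
no billiard/hard-sphere flow.

## Design choices

* Everything is stated for an arbitrary `Geometry` (the restart identities are pure
  bookkeeping of `ℝ≥0∞`-valued instants); only `stateAfter_mem_of_mem` uses a regular geometry.
* `FwdGoodUpTo` quantifies clause (ii) with `t_k + t ≤ T` in `ℝ≥0∞`, so that no finiteness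
  side conditions are needed, and clause (iii) (`∃ k, T < t_k`) replaces non-summability.

## References

* I. Gallagher, L. Saint-Raymond, B. Texier, *From Newton to Boltzmann: hard spheres and
  short-range potentials*, EMS (2013), arXiv:1208.5753, §4.1, Prop. 4.1.1 and its proof (p. 19).
* C. Cercignani, R. Illner, M. Pulvirenti, *The Mathematical Theory of Dilute Gases*, Springer
  (1994), §4.2 p. 65, App. 4.A p. 108 (the ceiling function of the special flow).
-/

open Set Filter Topology Function
open scoped ENNReal

namespace Literature.Analysis.FluidPDE

noncomputable section

section Kinetic

variable {d : Type*} [Fintype d] {X : Type*} {N : ℕ}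

namespace Alexander

variable {G : Geometry d X} {ε : ℝ}

/-! ## The exit time along a free flight -/

/-- **Equivariance of the exit time under free flight**: `τ(S_s z) + s = τ(z)` for
`0 ≤ s ≤ τ(z)` (the free flight restarted at `S_s z` leaves the domain at the same absolute
time; CIP 1994 App. 4.A, the special-flow picture). [cite: CIP1994, App. 4.A p. 108] -/
theorem freeExitTime_freeFlight_add {z : Config N d X} {s : ℝ} (hs : 0 ≤ s)
    (h : ENNReal.ofReal s ≤ freeExitTime G ε z) :
    freeExitTime G ε (freeFlight G s z) + ENNReal.ofReal s = freeExitTime G ε z := by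
  refine le_antisymm (le_sInf ?_) ?_
  · rintro b ⟨hb, hmem⟩
    have hsb : ENNReal.ofReal s ≤ b := h.trans (sInf_le ⟨hb, hmem⟩)
    have hsb' : s ≤ b.toReal := (ENNReal.ofReal_le_iff_le_toReal hb).1 hsb
    have h1 : freeExitTime G ε (freeFlight G s z) ≤ ENNReal.ofReal (b.toReal - s) := by
      refine freeExitTime_le_of_not_mem (sub_nonneg.2 hsb') ?_
      rwa [← freeFlight_add, sub_add_cancel]
    calc freeExitTime G ε (freeFlight G s z) + ENNReal.ofReal s
        ≤ ENNReal.ofReal (b.toReal - s) + ENNReal.ofReal s := add_le_add h1 le_rfl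
      _ = b := by
          rw [← ENNReal.ofReal_add (sub_nonneg.2 hsb') hs, sub_add_cancel, ENNReal.ofReal_toReal hb]
  · rw [← tsub_le_iff_right]
    refine le_sInf ?_
    rintro b ⟨hb, hmem⟩
    rw [tsub_le_iff_right]
    have h1 : freeExitTime G ε z ≤ ENNReal.ofReal (b.toReal + s) := by
      refine freeExitTime_le_of_not_mem (add_nonneg ENNReal.toReal_nonneg hs) ?_
      rwa [freeFlight_add]
    calc freeExitTime G ε z ≤ ENNReal.ofReal (b.toReal + s) := h1
      _ = b + ENNReal.ofReal s := by
          rw [ENNReal.ofReal_add ENNReal.toReal_nonneg hs, ENNReal.ofReal_toReal hb]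

/-- The exit time along a free flight, solved for `τ(S_s z)`: `τ(S_s z) = τ(z) - s` for
`0 ≤ s ≤ τ(z)`. [folklore] -/
theorem freeExitTime_freeFlight_eq_sub {z : Config N d X} {s : ℝ} (hs : 0 ≤ s)
    (h : ENNReal.ofReal s ≤ freeExitTime G ε z) :
    freeExitTime G ε (freeFlight G s z) = freeExitTime G ε z - ENNReal.ofReal s := by
  rw [← freeExitTime_freeFlight_add hs h, ENNReal.add_sub_cancel_right ENNReal.ofReal_ne_top]

/-- Along a free flight the exit configuration does not change: `S_{τ(S_s z)} (S_s z) = S_{τ(z)} z`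
for `0 ≤ s ≤ τ(z) < ∞`. [folklore] -/
theorem freeFlight_freeExitTime_freeFlight {z : Config N d X} {s : ℝ} (hs : 0 ≤ s)
    (h : ENNReal.ofReal s ≤ freeExitTime G ε z) (hτ : freeExitTime G ε z ≠ ∞) :
    freeFlight G (freeExitTime G ε (freeFlight G s z)).toReal (freeFlight G s z) =
      freeFlight G (freeExitTime G ε z).toReal z := by
  rw [← freeFlight_add]
  congr 1
  have h1 := freeExitTime_freeFlight_add (G := G) (ε := ε) hs h
  have hτ' : freeExitTime G ε (freeFlight G s z) ≠ ∞ := by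
    intro htop; rw [htop, top_add] at h1; exact hτ h1.symm
  rw [← h1, ENNReal.toReal_add hτ' ENNReal.ofReal_ne_top, ENNReal.toReal_ofReal hs]

/-- Along a free flight the collision step does not change: `T (S_s z) = T z` for
`0 ≤ s ≤ τ(z) < ∞`. [folklore] -/
theorem collisionStep_freeFlight {z : Config N d X} {s : ℝ} (hs : 0 ≤ s)
    (h : ENNReal.ofReal s ≤ freeExitTime G ε z) (hτ : freeExitTime G ε z ≠ ∞) :
    collisionStep G ε (freeFlight G s z) = collisionStep G ε z := by
  have h1 := freeExitTime_freeFlight_add (G := G) (ε := ε) hs h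
  have hτ' : freeExitTime G ε (freeFlight G s z) ≠ ∞ := by
    intro htop; rw [htop, top_add] at h1; exact hτ h1.symm
  rw [collisionStep, if_neg hτ', collisionStep, if_neg hτ]
  dsimp only
  rw [freeFlight_freeExitTime_freeFlight hs h hτ]

/-- If the free flight never leaves the domain, neither does the free flight restarted later:
`τ(z) = ∞ ⇒ τ(S_s z) = ∞` (`s ≥ 0`). [folklore] -/
theorem freeExitTime_freeFlight_eq_top {z : Config N d X} {s : ℝ} (hs : 0 ≤ s)
    (h : freeExitTime G ε z = ∞) : freeExitTime G ε (freeFlight G s z) = ∞ := by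
  have h1 := freeExitTime_freeFlight_add (G := G) (ε := ε) hs (h ▸ le_top)
  rw [h, ENNReal.add_eq_top] at h1
  exact h1.resolve_right ENNReal.ofReal_ne_top

/-! ## States and instants: reachability, membership in the domain -/

/-- After a free flight that never ends, the dynamics is frozen: `τ(z_m) = ∞ ⇒ z_k = z_m` for
`k ≥ m`. [folklore] -/
theorem stateAfter_eq_of_freeExitTime_eq_top {z : Config N d X} {m : ℕ}
    (hm : freeExitTime G ε (stateAfter G ε z m) = ∞) {k : ℕ} (hmk : m ≤ k) :
    stateAfter G ε z k = stateAfter G ε z m := by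
  induction k with
  | zero => rw [Nat.le_zero.1 hmk]
  | succ k ih =>
    rcases Nat.of_le_succ hmk with hle | rfl
    · rw [stateAfter_succ, ih hle, collisionStep_of_eq_top hm]
    · rfl

/-- A collision instant is finite iff all the earlier free flights are finite. [folklore] -/
theorem collisionInstant_ne_top_iff {z : Config N d X} {k : ℕ} :
    collisionInstant G ε z k ≠ ∞ ↔ ∀ m < k, freeExitTime G ε (stateAfter G ε z m) ≠ ∞ := by
  rw [collisionInstant, ENNReal.sum_ne_top]
  simp only [Finset.mem_range]

/-- Every state is a state reached at a finite instant: for each `k` there is `m ≤ k` with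
`t_m < ∞` and `z_k = z_m`. [folklore] -/
theorem exists_stateAfter_eq_reachable (z : Config N d X) (k : ℕ) :
    ∃ m ≤ k, collisionInstant G ε z m ≠ ∞ ∧ stateAfter G ε z k = stateAfter G ε z m := by
  classical
  let P : ℕ → Prop := fun m => freeExitTime G ε (stateAfter G ε z m) = ∞ ∨ m = k
  have hP : ∃ m, P m := ⟨k, Or.inr rfl⟩
  refine ⟨Nat.find hP, ?_, ?_, ?_⟩
  · exact Nat.find_min' hP (Or.inr rfl)
  · rw [collisionInstant_ne_top_iff]
    intro m hm htop
    exact Nat.find_min hP hm (Or.inl htop)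
  · rcases (Nat.find_spec hP : P (Nat.find hP)) with htop | heq
    · exact stateAfter_eq_of_freeExitTime_eq_top htop (Nat.find_min' hP (Or.inr rfl))
    · rw [heq]

section Regular

variable [TopologicalSpace X]

/-- The collision step maps the hard-sphere domain to itself (regular geometry: the exit
configuration lies in the closed domain, and collisions do not move particles). [folklore] -/
theorem collisionStep_mem (hG : G.IsHardSphereRegular ε) {z : Config N d X}
    (hz : z ∈ hardSphereDomain G N ε) : collisionStep G ε z ∈ hardSphereDomain G N ε := by
  by_cases hτ : freeExitTime G ε z = ∞
  · rwa [collisionStep_of_eq_top hτ]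
  · have hmem := freeFlight_freeExitTime_mem hG hz hτ
    rw [collisionStep, if_neg hτ]
    dsimp only
    split_ifs with h
    · exact (collidePair_mem_hardSphereDomain_iff _).2 hmem
    · exact hmem

/-- All post-collisional states of a datum of the domain lie in the domain (regular geometry;
no regularity of the orbit is needed). [folklore] -/
theorem stateAfter_mem_of_mem (hG : G.IsHardSphereRegular ε) {z : Config N d X}
    (hz : z ∈ hardSphereDomain G N ε) (k : ℕ) : stateAfter G ε z k ∈ hardSphereDomain G N ε := by
  induction k with
  | zero => exact hz
  | succ k ih => rw [stateAfter_succ]; exact collisionStep_mem hG ih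

end Regular

/-! ## Truncated forward regularity -/

variable (G ε) in
/-- **Forward regularity up to time `T`** of the collision-by-collision dynamics started at `z`
(the time-`T` truncation of `FwdGood`, i.e. the negation of "pathological before time `T`",
GST 2013 Prop. 4.1.1 with `t ∈ [0, T]`): (i) every free flight ending at an instant
`t_{k+1} ≤ T` ends in a simple incoming collision configuration; (ii) strictly inside the free
flights and up to time `T` no pair is in contact; (iii) some collision instant exceeds `T`
(finitely many collisions up to time `T`). Meaningful for `T ≥ 0`: for `T ≤ 0` all horizons
coincide with `T = 0`, since `ENNReal.ofReal T = 0`. [cite: GST2013, Prop. 4.1.1 p. 19] -/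
def FwdGoodUpTo (T : ℝ) (z : Config N d X) : Prop :=
  (∀ k, collisionInstant G ε z (k + 1) ≤ ENNReal.ofReal T →
      IsSimpleIncoming G ε
        (freeFlight G (freeExitTime G ε (stateAfter G ε z k)).toReal (stateAfter G ε z k))) ∧
  (∀ k (t : ℝ), 0 < t → ENNReal.ofReal t < freeExitTime G ε (stateAfter G ε z k) →
      collisionInstant G ε z k + ENNReal.ofReal t ≤ ENNReal.ofReal T →
      ∀ i j : Fin N, i ≠ j → freeFlight G t (stateAfter G ε z k) ∉ contactSet G N ε i j) ∧
  (∃ k, ENNReal.ofReal T < collisionInstant G ε z k)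

namespace FwdGoodUpTo

variable {T : ℝ} {z : Config N d X}

/-- Truncated regularity is monotone in the horizon. [folklore] -/
theorem mono (h : FwdGoodUpTo G ε T z) {T' : ℝ} (hT : T' ≤ T) : FwdGoodUpTo G ε T' z := by
  have hle : ENNReal.ofReal T' ≤ ENNReal.ofReal T := ENNReal.ofReal_le_ofReal hT
  refine ⟨fun k hk => h.1 k (hk.trans hle), fun k t ht htk hkt => h.2.1 k t ht htk (hkt.trans hle),
    ?_⟩
  obtain ⟨k, hk⟩ := h.2.2
  exact ⟨k, hle.trans_lt hk⟩

/-- Up to the horizon every time lies in a collision segment: for `0 ≤ s ≤ T` there is `k` with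
`t_k ≤ s < t_{k+1}`. [folklore] -/
theorem exists_segment (h : FwdGoodUpTo G ε T z) {s : ℝ} (hs : s ≤ T) :
    ∃ k, collisionInstant G ε z k ≤ ENNReal.ofReal s ∧
      ENNReal.ofReal s < collisionInstant G ε z (k + 1) := by
  classical
  obtain ⟨k0, hk0⟩ := h.2.2
  have hex : ∃ m, ENNReal.ofReal s < collisionInstant G ε z m :=
    ⟨k0, (ENNReal.ofReal_le_ofReal hs).trans_lt hk0⟩
  have hm0 : Nat.find hex ≠ 0 := by
    intro h0
    have := Nat.find_spec hex
    rw [h0, collisionInstant_zero] at this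
    exact ENNReal.not_lt_zero this
  obtain ⟨k, hk⟩ := Nat.exists_eq_add_one_of_ne_zero hm0
  refine ⟨k, ?_, by rw [← hk]; exact Nat.find_spec hex⟩
  have := Nat.find_min hex (m := k) (by omega)
  exact not_lt.1 this

end FwdGoodUpTo

/-- **Forward regularity is truncated forward regularity at every integer horizon.** [folklore] -/
theorem fwdGood_iff_forall_fwdGoodUpTo {z : Config N d X} :
    FwdGood G ε z ↔ ∀ n : ℕ, FwdGoodUpTo G ε n z := by
  constructor
  · rintro ⟨h1, h2, h3⟩ n
    refine ⟨fun k hk => h1 k ?_, fun k t ht htk _ => h2 k t ht htk, ?_⟩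
    · intro htop
      rw [collisionInstant_succ, htop, add_top] at hk
      exact ENNReal.ofReal_ne_top (top_unique hk)
    · -- non-accumulation: the instants are unbounded
      by_contra hno
      push Not at hno
      have hle : ∀ k, collisionInstant G ε z k ≤ ENNReal.ofReal n := hno
      have hsum : ∑' k, freeExitTime G ε (stateAfter G ε z k) ≤ ENNReal.ofReal n := by
        refine ENNReal.tsum_le_of_sum_range_le fun k => ?_
        exact hle k
      rw [h3] at hsum
      exact ENNReal.ofReal_ne_top (top_unique hsum)
  · intro h
    refine ⟨fun k hk => ?_, fun k t ht htk i j hij => ?_, ?_⟩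
    · -- (i): the instant `t_{k+1}` is finite, pick an integer horizon beyond it
      have hfin : collisionInstant G ε z (k + 1) ≠ ∞ := by
        rw [collisionInstant_ne_top_iff]
        intro m hm htop
        have heq := stateAfter_eq_of_freeExitTime_eq_top htop (Nat.le_of_lt_succ hm)
        rw [heq] at hk
        exact hk htop
      obtain ⟨n, hn⟩ := exists_nat_ge (collisionInstant G ε z (k + 1)).toReal
      refine (h n).1 k ?_
      rw [← ENNReal.ofReal_toReal hfin]
      exact ENNReal.ofReal_le_ofReal hn
    · -- (ii): reduce to a reachable index
      obtain ⟨m, -, hm, heq⟩ := exists_stateAfter_eq_reachable (G := G) (ε := ε) z k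
      rw [heq] at htk ⊢
      have hfin : collisionInstant G ε z m + ENNReal.ofReal t ≠ ∞ :=
        ENNReal.add_ne_top.2 ⟨hm, ENNReal.ofReal_ne_top⟩
      obtain ⟨n, hn⟩ := exists_nat_ge (collisionInstant G ε z m + ENNReal.ofReal t).toReal
      refine (h n).2.1 m t ht htk ?_ i j hij
      rw [← ENNReal.ofReal_toReal hfin]
      exact ENNReal.ofReal_le_ofReal hn
    · -- (iii): the instants are unbounded, so the exit times are not summable
      by_contra hne
      have hlt : ∑' k, freeExitTime G ε (stateAfter G ε z k) < ∞ := lt_top_iff_ne_top.2 hne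
      obtain ⟨n, hn⟩ := exists_nat_gt (∑' k, freeExitTime G ε (stateAfter G ε z k)).toReal
      obtain ⟨k, hk⟩ := (h n).2.2
      have hle : collisionInstant G ε z k ≤ ∑' k, freeExitTime G ε (stateAfter G ε z k) :=
        ENNReal.sum_le_tsum _
      have : ENNReal.ofReal n < ∑' k, freeExitTime G ε (stateAfter G ε z k) := hk.trans_le hle
      rw [← ENNReal.ofReal_toReal hne, ENNReal.ofReal_lt_ofReal_iff_of_nonneg (Nat.cast_nonneg n)]
        at this
      exact lt_asymm this hn

/-! ## Restarting the dynamics from a point of the orbit -/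

section Restart

variable {z : Config N d X} {s : ℝ} {k : ℕ}

/-- The data of a collision segment: `t_k ≤ s < t_{k+1}` gives `t_k < ∞`, `t_k ≤ s`,
`0 ≤ s - t_k` and `s - t_k < τ(z_k)` hence `s - t_k ≤ τ(z_k)`. [folklore] -/
theorem segment_arith (hs : 0 ≤ s) (h1 : collisionInstant G ε z k ≤ ENNReal.ofReal s)
    (h2 : ENNReal.ofReal s < collisionInstant G ε z (k + 1)) :
    collisionInstant G ε z k ≠ ∞ ∧ (collisionInstant G ε z k).toReal ≤ s ∧
      ENNReal.ofReal (s - (collisionInstant G ε z k).toReal) <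
        freeExitTime G ε (stateAfter G ε z k) ∧
      collisionInstant G ε z k + ENNReal.ofReal (s - (collisionInstant G ε z k).toReal) =
        ENNReal.ofReal s := by
  have hfin : collisionInstant G ε z k ≠ ∞ := ne_top_of_le_ne_top ENNReal.ofReal_ne_top h1
  have hle : (collisionInstant G ε z k).toReal ≤ s := ENNReal.toReal_le_of_le_ofReal hs h1
  refine ⟨hfin, hle, ?_, ?_⟩
  · rw [collisionInstant_succ] at h2
    exact ofReal_sub_toReal_lt hs h1 h2
  · rw [← ENNReal.ofReal_toReal hfin, ENNReal.toReal_ofReal ENNReal.toReal_nonneg,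
      ← ENNReal.ofReal_add ENNReal.toReal_nonneg (sub_nonneg.2 hle), add_sub_cancel]

/-- **Restart, states**: if `t_k ≤ s < t_{k+1}` and `τ(z_k) < ∞`, the dynamics restarted at
`w = Φ_s z = S_{s - t_k} z_k` has post-collisional states `w_m = z_{k+m}` for `m ≥ 1`. [folklore] -/
theorem stateAfter_fwdFlow_succ (hs : 0 ≤ s) (h1 : collisionInstant G ε z k ≤ ENNReal.ofReal s)
    (h2 : ENNReal.ofReal s < collisionInstant G ε z (k + 1))
    (hτ : freeExitTime G ε (stateAfter G ε z k) ≠ ∞) (m : ℕ) :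
    stateAfter G ε (fwdFlow G ε z s) (m + 1) = stateAfter G ε z (k + (m + 1)) := by
  obtain ⟨-, hle, hlt, -⟩ := segment_arith hs h1 h2
  rw [fwdFlow_eq_of_segment h1 h2]
  induction m with
  | zero =>
    rw [zero_add, ← stateAfter_stateAfter, stateAfter_one, stateAfter_one]
    exact collisionStep_freeFlight (sub_nonneg.2 hle) hlt.le hτ
  | succ m ih =>
    rw [stateAfter_succ, ih, ← stateAfter_succ, Nat.add_assoc]

/-- **Restart, instants**: if `t_k ≤ s < t_{k+1}`, the collision instants of the restarted
dynamics are the later instants of the original one shifted by `s`: `t^w_m + s = t_{k+m}` for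
`m ≥ 1`. [folklore] -/
theorem collisionInstant_fwdFlow_succ_add (hs : 0 ≤ s)
    (h1 : collisionInstant G ε z k ≤ ENNReal.ofReal s)
    (h2 : ENNReal.ofReal s < collisionInstant G ε z (k + 1)) (m : ℕ) :
    collisionInstant G ε (fwdFlow G ε z s) (m + 1) + ENNReal.ofReal s =
      collisionInstant G ε z (k + (m + 1)) := by
  obtain ⟨hfin, hle, hlt, hsplit⟩ := segment_arith hs h1 h2
  have hw : fwdFlow G ε z s =
      freeFlight G (s - (collisionInstant G ε z k).toReal) (stateAfter G ε z k) :=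
    fwdFlow_eq_of_segment h1 h2
  have hshift : freeExitTime G ε (fwdFlow G ε z s) +
      ENNReal.ofReal (s - (collisionInstant G ε z k).toReal) =
        freeExitTime G ε (stateAfter G ε z k) := by
    rw [hw]; exact freeExitTime_freeFlight_add (sub_nonneg.2 hle) hlt.le
  induction m with
  | zero =>
    rw [zero_add, collisionInstant_one, collisionInstant_succ, ← hshift, ← hsplit]
    ring
  | succ m ih =>
    by_cases hτ : freeExitTime G ε (stateAfter G ε z k) = ∞
    · -- frozen dynamics: all later instants are infinite on both sides
      have hw' : freeExitTime G ε (fwdFlow G ε z s) = ∞ := by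
        rw [hw]; exact freeExitTime_freeFlight_eq_top (sub_nonneg.2 hle) hτ
      have hl : collisionInstant G ε (fwdFlow G ε z s) (m + 1 + 1) = ∞ := by
        refine top_unique ?_
        calc (⊤ : ℝ≥0∞) = collisionInstant G ε (fwdFlow G ε z s) 1 := by
              rw [collisionInstant_one, hw']
          _ ≤ _ := monotone_collisionInstant _ (by omega)
      have hr : collisionInstant G ε z (k + (m + 1 + 1)) = ∞ := by
        refine top_unique ?_
        calc (⊤ : ℝ≥0∞) = collisionInstant G ε z (k + 1) := by
              rw [collisionInstant_succ, hτ, add_top]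
          _ ≤ _ := monotone_collisionInstant _ (by omega)
      rw [hl, hr, top_add]
    · rw [collisionInstant_succ, stateAfter_fwdFlow_succ hs h1 h2 hτ m, add_right_comm, ih,
        show k + (m + 1 + 1) = (k + (m + 1)) + 1 by omega, collisionInstant_succ]

/-- **Restart, the flow**: `Φ_{s+u} z = Φ_u (Φ_s z)` for `s, u ≥ 0`, as soon as `s` lies in a
collision segment of `z` and `u` in one of `Φ_s z` (no regularity beyond that is needed).
[folklore] -/
theorem fwdFlow_add_of_segment (hs : 0 ≤ s) {u : ℝ} (hu : 0 ≤ u)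
    (h1 : collisionInstant G ε z k ≤ ENNReal.ofReal s)
    (h2 : ENNReal.ofReal s < collisionInstant G ε z (k + 1)) {m : ℕ}
    (h1' : collisionInstant G ε (fwdFlow G ε z s) m ≤ ENNReal.ofReal u)
    (h2' : ENNReal.ofReal u < collisionInstant G ε (fwdFlow G ε z s) (m + 1)) :
    fwdFlow G ε z (s + u) = fwdFlow G ε (fwdFlow G ε z s) u := by
  obtain ⟨hfin, hle, hlt, hsplit⟩ := segment_arith hs h1 h2
  have hsu : ENNReal.ofReal (s + u) = ENNReal.ofReal u + ENNReal.ofReal s := by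
    rw [add_comm, ENNReal.ofReal_add hu hs]
  rw [fwdFlow_eq_of_segment h1' h2']
  rcases Nat.eq_zero_or_pos m with rfl | hm
  · -- still in the first free flight of the restarted dynamics
    have hA : collisionInstant G ε z k ≤ ENNReal.ofReal (s + u) :=
      h1.trans (ENNReal.ofReal_le_ofReal (by linarith))
    have hB : ENNReal.ofReal (s + u) < collisionInstant G ε z (k + 1) := by
      rw [hsu, ← collisionInstant_fwdFlow_succ_add hs h1 h2 0]
      exact ENNReal.add_lt_add_right ENNReal.ofReal_ne_top h2'
    rw [fwdFlow_eq_of_segment hA hB, stateAfter_zero, collisionInstant_zero, ENNReal.toReal_zero,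
      sub_zero, fwdFlow_eq_of_segment h1 h2, ← freeFlight_add]
    congr 1
    ring
  · obtain ⟨m, rfl⟩ := Nat.exists_eq_add_one_of_ne_zero hm.ne'
    have hinst := collisionInstant_fwdFlow_succ_add hs h1 h2 m
    have hA : collisionInstant G ε z (k + (m + 1)) ≤ ENNReal.ofReal (s + u) := by
      rw [hsu, ← hinst]
      exact add_le_add h1' le_rfl
    have hB : ENNReal.ofReal (s + u) < collisionInstant G ε z (k + (m + 1) + 1) := by
      rw [hsu, show k + (m + 1) + 1 = k + (m + 1 + 1) by omega,
        ← collisionInstant_fwdFlow_succ_add hs h1 h2 (m + 1)]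
      exact ENNReal.add_lt_add_right ENNReal.ofReal_ne_top h2'
    have hfin' : collisionInstant G ε (fwdFlow G ε z s) (m + 1) ≠ ∞ :=
      ne_top_of_le_ne_top ENNReal.ofReal_ne_top h1'
    have hτ : freeExitTime G ε (stateAfter G ε z k) ≠ ∞ := by
      intro htop
      have : collisionInstant G ε z (k + (m + 1)) = ∞ := by
        refine top_unique ?_
        calc (⊤ : ℝ≥0∞) = collisionInstant G ε z (k + 1) := by
              rw [collisionInstant_succ, htop, add_top]
          _ ≤ _ := monotone_collisionInstant _ (by omega)
      rw [this] at hA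
      exact ENNReal.ofReal_ne_top (top_unique hA)
    rw [fwdFlow_eq_of_segment hA hB, stateAfter_fwdFlow_succ hs h1 h2 hτ m]
    congr 1
    have htR : (collisionInstant G ε z (k + (m + 1))).toReal =
        (collisionInstant G ε (fwdFlow G ε z s) (m + 1)).toReal + s := by
      rw [← hinst, ENNReal.toReal_add hfin' ENNReal.ofReal_ne_top, ENNReal.toReal_ofReal hs]
    rw [htR]
    ring

/-- **Restart of truncated regularity**: if `z` is forward regular up to time `s` and `Φ_s z`
is forward regular up to time `u`, then `z` is forward regular up to time `s + u`, and
`Φ_{s+u} z = Φ_u (Φ_s z)` (the collision-by-collision dynamics restarted at a point of the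
orbit reproduces the orbit; CIP 1994 §4.2, `T^t T^s = T^{t+s}`, here before knowing that the
orbit is globally good). [cite: CIP1994, §4.2 p. 65] -/
theorem FwdGoodUpTo.add {u : ℝ} (hs : 0 ≤ s) (hu : 0 ≤ u) (hz : FwdGoodUpTo G ε s z)
    (hw : FwdGoodUpTo G ε u (fwdFlow G ε z s)) :
    FwdGoodUpTo G ε (s + u) z ∧ fwdFlow G ε z (s + u) = fwdFlow G ε (fwdFlow G ε z s) u := by
  obtain ⟨k, h1, h2⟩ := hz.exists_segment le_rfl
  obtain ⟨hfin, hle, hlt, hsplit⟩ := segment_arith hs h1 h2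
  have hweq : fwdFlow G ε z s =
      freeFlight G (s - (collisionInstant G ε z k).toReal) (stateAfter G ε z k) :=
    fwdFlow_eq_of_segment h1 h2
  have hsu : ENNReal.ofReal (s + u) = ENNReal.ofReal u + ENNReal.ofReal s := by
    rw [add_comm, ENNReal.ofReal_add hu hs]
  have hshift : freeExitTime G ε (fwdFlow G ε z s) +
      ENNReal.ofReal (s - (collisionInstant G ε z k).toReal) =
        freeExitTime G ε (stateAfter G ε z k) := by
    rw [hweq]; exact freeExitTime_freeFlight_add (sub_nonneg.2 hle) hlt.le
  have hinst := collisionInstant_fwdFlow_succ_add hs h1 h2   -- t^w_{m+1} + s = t_{k+m+1}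
  -- instants beyond `s` force `τ(z_k) < ∞`
  have hτ_of_le : ∀ {m : ℕ} {c : ℝ≥0∞}, c ≠ ∞ → collisionInstant G ε z (k + (m + 1)) ≤ c →
      freeExitTime G ε (stateAfter G ε z k) ≠ ∞ := by
    intro m c hc hmc htop
    have : collisionInstant G ε z (k + (m + 1)) = ∞ := by
      refine top_unique ?_
      calc (⊤ : ℝ≥0∞) = collisionInstant G ε z (k + 1) := by
            rw [collisionInstant_succ, htop, add_top]
        _ ≤ _ := monotone_collisionInstant _ (by omega)
    rw [this] at hmc
    exact hc (top_unique hmc)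
  -- an index `k'` whose segment reaches beyond `s` is `≥ k`
  have hk_le : ∀ {k' : ℕ}, ENNReal.ofReal s < collisionInstant G ε z (k' + 1) → k ≤ k' := by
    intro k' hk'
    by_contra hlt'
    have : collisionInstant G ε z (k' + 1) ≤ collisionInstant G ε z k :=
      monotone_collisionInstant _ (by omega)
    exact (not_le.2 hk') (this.trans h1)
  refine ⟨⟨fun k' hk' => ?_, fun k' t ht htk hkt i j hij => ?_, ?_⟩,
    (hw.exists_segment le_rfl).elim fun m hm => fwdFlow_add_of_segment hs hu h1 h2 hm.1 hm.2⟩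
  · -- (i) simple incoming exits up to time `s + u`
    by_cases hcase : collisionInstant G ε z (k' + 1) ≤ ENNReal.ofReal s
    · exact hz.1 k' hcase
    obtain ⟨m, rfl⟩ := Nat.exists_eq_add_of_le (hk_le (not_le.1 hcase))
    rw [Nat.add_assoc] at hk'
    have hτ : freeExitTime G ε (stateAfter G ε z k) ≠ ∞ :=
      hτ_of_le ENNReal.ofReal_ne_top hk'
    have hwm : collisionInstant G ε (fwdFlow G ε z s) (m + 1) ≤ ENNReal.ofReal u := by
      rw [hsu, ← hinst m] at hk'
      exact (ENNReal.add_le_add_iff_right ENNReal.ofReal_ne_top).1 hk'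
    have key := hw.1 m hwm
    rcases Nat.eq_zero_or_pos m with rfl | hmpos
    · -- the current free flight of `z_k`, seen from `Φ_s z`
      rw [stateAfter_zero, hweq, freeFlight_freeExitTime_freeFlight (sub_nonneg.2 hle) hlt.le hτ]
        at key
      simpa only [add_zero] using key
    · obtain ⟨m, rfl⟩ := Nat.exists_eq_add_one_of_ne_zero hmpos.ne'
      rwa [stateAfter_fwdFlow_succ hs h1 h2 hτ m] at key
  · -- (ii) no touch inside the free flights up to time `s + u`
    by_cases hcase : collisionInstant G ε z k' + ENNReal.ofReal t ≤ ENNReal.ofReal s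
    · exact hz.2.1 k' t ht htk hcase i j hij
    have hfin' : collisionInstant G ε z k' ≠ ∞ := by
      intro htop; rw [htop, top_add] at hkt; exact ENNReal.ofReal_ne_top (top_unique hkt)
    have hk' : k ≤ k' := by
      refine hk_le (lt_of_lt_of_le (not_le.1 hcase) ?_)
      rw [collisionInstant_succ]
      exact add_le_add le_rfl htk.le
    obtain ⟨m, rfl⟩ := Nat.exists_eq_add_of_le hk'
    rcases Nat.eq_zero_or_pos m with rfl | hmpos
    · -- inside the current free flight of `z_k`: time `t - (s - t_k)` after `Φ_s z`
      simp only [add_zero] at htk hkt hcase ⊢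
      have hta : s - (collisionInstant G ε z k).toReal < t := by
        by_contra hle'
        push Not at hle'
        apply hcase
        calc collisionInstant G ε z k + ENNReal.ofReal t
            ≤ collisionInstant G ε z k +
                ENNReal.ofReal (s - (collisionInstant G ε z k).toReal) := by
              gcongr
          _ = ENNReal.ofReal s := hsplit
      have heq : freeFlight G t (stateAfter G ε z k) =
          freeFlight G (t - (s - (collisionInstant G ε z k).toReal)) (fwdFlow G ε z s) := by
        rw [hweq, ← freeFlight_add, sub_add_cancel]
      rw [heq]
      refine hw.2.1 0 (t - (s - (collisionInstant G ε z k).toReal)) (sub_pos.2 hta) ?_ ?_ i j hij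
      · rw [stateAfter_zero]
        have : ENNReal.ofReal t = ENNReal.ofReal (t - (s - (collisionInstant G ε z k).toReal)) +
            ENNReal.ofReal (s - (collisionInstant G ε z k).toReal) := by
          rw [← ENNReal.ofReal_add (sub_pos.2 hta).le (sub_nonneg.2 hle), sub_add_cancel]
        rw [← hshift, this] at htk
        exact (ENNReal.add_lt_add_iff_right ENNReal.ofReal_ne_top).1 htk
      · rw [collisionInstant_zero, zero_add]
        refine ENNReal.ofReal_le_ofReal ?_
        have h3 : (collisionInstant G ε z k).toReal + t ≤ s + u := by
          have := hkt
          rw [← ENNReal.ofReal_toReal hfin, ← ENNReal.ofReal_add ENNReal.toReal_nonneg ht.le]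
            at this
          exact (ENNReal.ofReal_le_ofReal_iff (by linarith)).1 this
        linarith
    · obtain ⟨m, rfl⟩ := Nat.exists_eq_add_one_of_ne_zero hmpos.ne'
      have hτ : freeExitTime G ε (stateAfter G ε z k) ≠ ∞ :=
        hτ_of_le (c := ENNReal.ofReal (s + u)) ENNReal.ofReal_ne_top
          ((le_add_right le_rfl).trans hkt)
      rw [← stateAfter_fwdFlow_succ hs h1 h2 hτ m] at htk ⊢
      refine hw.2.1 (m + 1) t ht htk ?_ i j hij
      rw [hsu, ← hinst m, add_right_comm] at hkt
      exact (ENNReal.add_le_add_iff_right ENNReal.ofReal_ne_top).1 hkt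
  · -- (iii) an instant beyond `s + u`
    obtain ⟨m, hm⟩ := hw.2.2
    have hm0 : m ≠ 0 := by
      rintro rfl
      rw [collisionInstant_zero] at hm
      exact ENNReal.not_lt_zero hm
    obtain ⟨m, rfl⟩ := Nat.exists_eq_add_one_of_ne_zero hm0
    refine ⟨k + (m + 1), ?_⟩
    rw [hsu, ← hinst m]
    exact ENNReal.add_lt_add_right ENNReal.ofReal_ne_top hm

end Restart

/-- The forward flow stays in the domain up to the horizon of truncated regularity (in fact on
every collision segment, by definition of the exit time). [folklore] -/
theorem FwdGoodUpTo.fwdFlow_mem {T : ℝ} {z : Config N d X} (h : FwdGoodUpTo G ε T z) {s : ℝ}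
    (hs0 : 0 ≤ s) (hs : s ≤ T) : fwdFlow G ε z s ∈ hardSphereDomain G N ε := by
  obtain ⟨k, h1, h2⟩ := h.exists_segment hs
  obtain ⟨-, hle, hlt, -⟩ := segment_arith hs0 h1 h2
  rw [fwdFlow_eq_of_segment h1 h2]
  exact freeFlight_mem_hardSphereDomain_of_lt (sub_nonneg.2 hle) hlt

end Alexander

end Kinetic

end

end Literature.Analysis.FluidPDE
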